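import Summits.QuantumFields.BalabanUV.Beta.GAN24.ArrowScaling
import Summits.QuantumFields.BalabanUV.Beta.GAN24.ArrowUnitBlock
import Summits.QuantumFields.BalabanUV.Beta.GAN24.ArrowAnchorDecoupled
import Summits.QuantumFields.BalabanUV.Beta.GAN24.ArrowAnchorZeroMomenta

/-!
# `BalabanUV.Beta.GAN24.ArrowAnchorZero` — binder row G-an2-4 / (CONV-C), road P1-fibre, p1 row **P1-L10** `FibreStrip` ((I3′), the strip half of the K-slot),
# L10 owner leaf-16's cut «(M4) scaled alias-space Neumann, two anchors» (= SKELETON-P1 A5 v0.3, `HOME/b2b-balaban-gan24-formalise-leaf-16/L10-CUT-M4.md`),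
# row **F3** `ArrowAnchorZero` — THE INNER ANCHOR: for every `D`, every `N ≥ 1`, the inner-scaled arrow matrix of the U = 1 KKT Bloch fibre AT `p = 0` is
# invertible with `‖(arrowMat (innerArrow N 0))⁻¹‖ ≤ 5/2` (`aZ = 5/2`, `N`-free)

NOT IN PRINT; OUR PROOF ATTEMPT (of the road; THIS file is [folklore] assembly of the cell's landed algebra: F1a `ArrowOperator`, F1b `ArrowNorms`, F1c `ArrowScaling`,
F1d `ArrowUnitBlock` (leaf-16), and this row's parts 1–2 `ArrowAnchorZeroMomenta` / `ArrowAnchorDecoupled` (leaf-15) — every input BY NAME).  HONEST FRAMING (cell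
contract, verbatim): «discharging `BetaPertH` makes Bałaban's UV stability UNCONDITIONAL — a real constructive-QFT result; it is NOT the continuum limit and NOT the
Clay problem.»  HONEST DEPENDENCY (verbatim): «continuum YM on T⁴ ⇐ BetaPertH ∧ nine spine estimates (0/9 proved); BetaPertH ⇐ (D1) ∧ (D4) ∧ CAP+tail; G-an2-4
gates asym, D1 and NE2/3/4.»  No cited fact, no `def`, no `def … : Prop` hypothesis, no wall binder; nothing of the K-slot `GAN24.CombesThomas.ConvCK 3 Lc` of
(CONV-C) is discharged here — this is ONE of the four shapes (F3–F6) that row F7 turns into (U1) + the strip a-priori bound.  NOT summit progress.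

## What is proved (generic `D`, `N ≥ 1`; `innerArrow N p = scaledArrow N (radI N) 1 p` of F1c; `p = 0` is the literal `(0 : Fin D → ℂ)`)
* §1 THE BRIDGE F1c ↔ F1d: `uBlock d = ArrowUnitBlock.unitKKT d` (entrywise), hence `Σ_κ ‖d κ‖² = 1 ⇒ IsUnit (uBlock d) ∧ ‖(uBlock d)⁻¹‖ ≤ 5/2`.
* §2 THE DATA OF `innerArrow N 0`: off the zero alias the border weights VANISH (`innerArrow_locW_zero_of_ne`, `innerArrow_borW_zero_of_ne` — part 1's
  `chiHat_zero_of_ne_zero`/`chiHat_mul_sflat_zero_of_ne_zero`/`boxS_zero_of_ne_zero`/`boxSs_zero_of_ne_zero` × F1c's literal scalings), at the zero alias they are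
  EXACTLY `1` (`innerArrow_locW_zero_zero`, `innerArrow_borW_zero_zero`: `(N²/1)·(1·N)·(1/N³)`, `(N³/1)·1·(1/N³)`, `(1/N^{D+1})·N^D·(N/1)`, `N^{−(D+1)}·N^{D+1}·1` from
  `FibreArrowBZ.chiHat_zero_zero/sflat_zero_zero/boxS_zero_zero/boxSs_zero_zero` and `radI N 0 = 1`), the zero-alias block is `0` and every other block is a
  unit KKT block (F1c `innerArrow_T_zero_zero` / `innerArrow_T_zero_of_ne` + `sum_norm_sq_unitSym`).
* §3 **`isUnit_innerArrow_zero`**: `IsUnit (arrowMat (innerArrow N 0)) ∧ ‖(arrowMat (innerArrow N 0))⁻¹‖ ≤ 5/2` (part 2's `isUnit_decoupled` with `m₀ = 0`,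
  `t = 5/2`), the a-priori form `apriori_innerArrow_zero`, and the `hZ`-slot packaging for leaf-09's `FibreDetStripOfAnchors.inner_case` with
  `Gin p := arrowMat (innerArrow N p)`.
Unit `b2b-balaban-gan24-formalise-leaf-15` (G-an2-4 formalisation swarm; `CLAIM P1-L10-F3` journal 2026-08-20T00:42Z), 2026-08-20.  Value = row F3 of L10's
route (M4) = the anchor of its inner Neumann step; NOT (I3′), NOT the K-slot, NOT BetaPertH.
-/

noncomputable section

open Matrix WithLp Complex Finset
open scoped Matrix.Norms.L2Operator BigOperators ComplexConjugate
open Literature.Probability.LatticeModels (TorusSite)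
open Literature.MathematicalPhysics.QuantumFieldTheory.Balaban1983to89.Beta
open Summit.QuantumFields.BalabanUV.Beta.GAN24.ArrowOperator
open Summit.QuantumFields.BalabanUV.Beta.GAN24.ArrowOperator.ArrowData
open Summit.QuantumFields.BalabanUV.Beta.GAN24.ArrowScaling
open Summit.QuantumFields.BalabanUV.Beta.GAN24.ArrowUnitBlock (unitKKT unitKKT_apply_inl_inl unitKKT_apply_inl_inr unitKKT_apply_inr_inl
  unitKKT_apply_inr_inr isUnit_and_norm_inv_unitKKT_le)
open Summit.QuantumFields.BalabanUV.Beta.GAN24.ArrowAnchorDecoupled (apriori_decoupled isUnit_decoupled)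
open Summit.QuantumFields.BalabanUV.Beta.GAN24.ArrowAnchorZeroMomenta (chiHat_zero_of_ne_zero chiHat_mul_sflat_zero_of_ne_zero boxS_zero_of_ne_zero
  boxSs_zero_of_ne_zero)
open Summit.QuantumFields.BalabanUV.Beta.GAN24.FibreArrowBZ (chiHat_zero_zero sflat_zero_zero boxS_zero_zero boxSs_zero_zero)

namespace Summit.QuantumFields.BalabanUV.Beta.GAN24.ArrowAnchorZero

variable {D : ℕ}

/-! ## §1 The bridge between F1c's `uBlock` and F1d's `unitKKT` -/

/-- [folklore] **`uBlock d = unitKKT d`** (F1c's `tBlock d (star d) 1` is E1's frame model `[[2(1 − d dᴴ), −d],[dᴴ, 0]]` of F1d, entry by entry). -/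
theorem uBlock_eq_unitKKT (d : Fin D → ℂ) : uBlock d = unitKKT d := by
  ext i j
  rcases i with κ | u <;> rcases j with l | u'
  · rw [unitKKT_apply_inl_inl]
    simp only [uBlock, tBlock, of_apply, Pi.star_apply, Complex.star_def]
  · rw [unitKKT_apply_inl_inr]
    simp only [uBlock, tBlock, of_apply, one_mul]
  · rw [unitKKT_apply_inr_inl]
    simp only [uBlock, tBlock, of_apply, one_mul, Pi.star_apply, Complex.star_def]
  · rw [unitKKT_apply_inr_inr]
    simp only [uBlock, tBlock, of_apply]

/-- [folklore] Hence a unit KKT block of F1c is invertible with `‖inverse‖ ≤ 5/2` (F1d `isUnit_and_norm_inv_unitKKT_le`). -/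
theorem isUnit_and_norm_inv_uBlock_le {d : Fin D → ℂ} (h : ∑ κ, ‖d κ‖ ^ 2 = 1) : IsUnit (uBlock d) ∧ ‖(uBlock d)⁻¹‖ ≤ 5 / 2 := by
  rw [uBlock_eq_unitKKT]
  exact isUnit_and_norm_inv_unitKKT_le h

/-! ## §2 The data of the inner-scaled arrow matrix at `p = 0` -/

section Data

variable {N : ℕ} [NeZero N]

/-- [folklore] The inner radius of the zero alias is `1`. -/
theorem radI_zero : radI N (0 : TorusSite D N) = 1 := by
  simp [radI]

/-- [folklore] OFF THE ZERO ALIAS THE EL/G BORDER WEIGHTS VANISH at `p = 0` (any scaling: the raw weights `χ̂(m)·s♭_κ(m)`, `χ̂(m)` vanish — part 1). -/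
theorem innerArrow_locW_zero_of_ne {m : TorusSite D N} (hm : m ≠ 0) : (innerArrow N (0 : Fin D → ℂ)).locW m = 0 := by
  funext s
  rcases s with κ | u
  · show (scaledArrow N (radI N) 1 (0 : Fin D → ℂ)).wE m κ = 0
    rw [scaledArrow_wE, chiHat_mul_sflat_zero_of_ne_zero hm κ, mul_zero, zero_mul]
  · show (scaledArrow N (radI N) 1 (0 : Fin D → ℂ)).wG m = 0
    rw [scaledArrow_wG, chiHat_zero_of_ne_zero hm, mul_zero, zero_mul]

/-- [folklore] OFF THE ZERO ALIAS THE Q/M BORDER WEIGHTS VANISH at `p = 0` (raw weights `S(m)s_κ(m)`, `S(m)` vanish — part 1). -/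
theorem innerArrow_borW_zero_of_ne {m : TorusSite D N} (hm : m ≠ 0) : (innerArrow N (0 : Fin D → ℂ)).borW m = 0 := by
  funext s
  rcases s with κ | u
  · show (scaledArrow N (radI N) 1 (0 : Fin D → ℂ)).wQ m κ = 0
    rw [scaledArrow_wQ, boxSs_zero_of_ne_zero hm κ, mul_zero, zero_mul]
  · show (scaledArrow N (radI N) 1 (0 : Fin D → ℂ)).wM m = 0
    rw [scaledArrow_wM, boxS_zero_of_ne_zero hm, mul_zero, zero_mul]

/-- [folklore] AT THE ZERO ALIAS THE SCALED EL/G BORDER WEIGHTS ARE EXACTLY `1`: `(N²/1²)·(χ̂(0)·s♭_κ(0))·(1²/N³) = N²·N/N³`, `(N³/1³)·χ̂(0)·(1³/N³) = 1`. -/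
theorem innerArrow_locW_zero_zero (s : Loc D) : (innerArrow N (0 : Fin D → ℂ)).locW 0 s = 1 := by
  have hN : (N : ℂ) ≠ 0 := Nat.cast_ne_zero.2 (NeZero.ne N)
  rcases s with κ | u
  · show (scaledArrow N (radI N) 1 (0 : Fin D → ℂ)).wE 0 κ = 1
    rw [scaledArrow_wE, chiHat_zero_zero, sflat_zero_zero, radI_zero]
    push_cast
    field_simp
  · show (scaledArrow N (radI N) 1 (0 : Fin D → ℂ)).wG 0 = 1
    rw [scaledArrow_wG, chiHat_zero_zero, radI_zero]
    push_cast
    field_simp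

/-- [folklore] AT THE ZERO ALIAS THE SCALED Q/M BORDER WEIGHTS ARE EXACTLY `1`: `N^{−(D+1)}·N^{D+1}·1`, `(1/N^{D+1})·N^D·(N/1)`. -/
theorem innerArrow_borW_zero_zero (s : Loc D) : (innerArrow N (0 : Fin D → ℂ)).borW 0 s = 1 := by
  have hN : (N : ℂ) ≠ 0 := Nat.cast_ne_zero.2 (NeZero.ne N)
  rcases s with κ | u
  · show (scaledArrow N (radI N) 1 (0 : Fin D → ℂ)).wQ 0 κ = 1
    rw [scaledArrow_wQ, boxSs_zero_zero]
    push_cast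
    field_simp
  · show (scaledArrow N (radI N) 1 (0 : Fin D → ℂ)).wM 0 = 1
    rw [scaledArrow_wM, boxS_zero_zero, radI_zero]
    push_cast
    field_simp
    ring

/-- [folklore] OFF THE ZERO ALIAS EVERY INNER-SCALED BLOCK AT `p = 0` IS INVERTIBLE WITH `‖inverse‖ ≤ 5/2` (F1c `innerArrow_T_zero_of_ne` + `sum_norm_sq_unitSym`, §1). -/
theorem innerArrow_T_zero_ape {m : TorusSite D N} (hm : m ≠ 0) :
    IsUnit ((innerArrow N (0 : Fin D → ℂ)).T m) ∧ ‖((innerArrow N (0 : Fin D → ℂ)).T m)⁻¹‖ ≤ 5 / 2 := by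
  rw [innerArrow_T_zero_of_ne hm]
  exact isUnit_and_norm_inv_uBlock_le (sum_norm_sq_unitSym (radO_zero_pos_of_ne hm))

end Data

/-! ## §3 Row F3: the inner anchor -/

section Anchor

variable {N : ℕ} [NeZero N]

/-- [folklore] **THE INNER A-PRIORI BOUND AT `p = 0`**: `‖(xl, xb)‖₂ ≤ (5/2)·‖arrowMat (innerArrow N 0) (xl, xb)‖₂` for all local/border data — `N`-free. -/
theorem apriori_innerArrow_zero (xl : Loc D × TorusSite D N → ℂ) (xb : Loc D → ℂ) :
    ‖(toLp 2 (Sum.elim xl xb) : EuclideanSpace ℂ (AIdx D (TorusSite D N)))‖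
      ≤ 5 / 2 * ‖(toLp 2 (arrowMat (innerArrow N (0 : Fin D → ℂ)) *ᵥ Sum.elim xl xb) : EuclideanSpace ℂ (AIdx D (TorusSite D N)))‖ :=
  apriori_decoupled (innerArrow N (0 : Fin D → ℂ)) 0 (by norm_num) innerArrow_T_zero_zero (fun _ hm => innerArrow_T_zero_ape hm)
    (fun _ hm => innerArrow_locW_zero_of_ne hm) (fun _ hm => innerArrow_borW_zero_of_ne hm)
    (fun s => by rw [innerArrow_locW_zero_zero s, norm_one]) (fun s => by rw [innerArrow_borW_zero_zero s, norm_one]) xl xb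

/-- [folklore] **ROW F3 — THE INNER ANCHOR**: for every `D` and every `N ≥ 1`, `arrowMat (innerArrow N 0)` is invertible and `‖(arrowMat (innerArrow N 0))⁻¹‖ ≤ 5/2`.
This is the `hZ` slot (`aZ = 5/2`) of `FibreDetStripOfAnchors.inner_case` with `Gin p := arrowMat (innerArrow N p)`. -/
theorem isUnit_innerArrow_zero :
    IsUnit (arrowMat (innerArrow N (0 : Fin D → ℂ))) ∧ ‖(arrowMat (innerArrow N (0 : Fin D → ℂ)))⁻¹‖ ≤ 5 / 2 :=
  isUnit_decoupled (innerArrow N (0 : Fin D → ℂ)) 0 (by norm_num) innerArrow_T_zero_zero (fun _ hm => innerArrow_T_zero_ape hm)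
    (fun _ hm => innerArrow_locW_zero_of_ne hm) (fun _ hm => innerArrow_borW_zero_of_ne hm)
    (fun s => by rw [innerArrow_locW_zero_zero s, norm_one]) (fun s => by rw [innerArrow_borW_zero_zero s, norm_one])

/-- [folklore] The `hZ`-slot in FAMILY form: with `Gin p := arrowMat (innerArrow N p)`, `IsUnit (Gin 0) ∧ ‖(Gin 0)⁻¹‖ ≤ 5/2` (for leaf-09's `inner_case`). -/
theorem hZ_innerArrow :
    IsUnit ((fun p : Fin D → ℂ => arrowMat (innerArrow N p)) 0) ∧ ‖((fun p : Fin D → ℂ => arrowMat (innerArrow N p)) 0)⁻¹‖ ≤ 5 / 2 :=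
  isUnit_innerArrow_zero

/-- [folklore] In particular (U1) holds at `p = 0` from the inner scaling alone (F1c `det_ne_zero_of_isUnit_innerArrow`; a consistency check — an2's
`det_trigPolySymbol_ne_zero` covers every real momentum). -/
theorem det_ne_zero_at_zero {d : ℕ} {N : ℕ} [NeZero N] :
    (FibreInverseDecay.trigPolySymbol (BlochFibreMatrix.stencil (d + 1)) (BlochFibreMatrix.pieceMatrix (N := N)) (0 : Fin (d + 1) → ℂ)).det ≠ 0 :=
  det_ne_zero_of_isUnit_innerArrow (0 : Fin (d + 1) → ℂ) isUnit_innerArrow_zero.1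

end Anchor

end Summit.QuantumFields.BalabanUV.Beta.GAN24.ArrowAnchorZero

end
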